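import Mathlib
import HarnessLib
import Literature.Computability.AlgebraicComplexity.PatternExpressions
import Literature.Computability.AlgebraicComplexity.SymmetricOrbitCircuitEval
import Summits.ValiantsHypothesis.ValiantsHypothesis.Theorems.MonotoneRestorationMonotoneRestorationQPSparseRegime

/-!
# Route MonotoneRestoration — `OrbitCompressionQP` (stmt-18332 = `stub_orbitCompression` of line
# `orbit_cut` of `NonnegRestorationQP`, stmt-16191): the registered first half of line
# `expression_compression` is FALSE AS STATED

Line `Cruxes/OrbitCompressionQP/Lines/expression_compression.lean` (line-writer, 2026-08-31) cuts
`OrbitCompressionQP` into `stub_orbitToNarrowExpression` ("a family with square-symmetric circuits of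
quasi-polynomial ORBIT size is, at every level `n ≥ 1`, the closed polynomial of a labelled bipartite
pattern expression with `k + l` labels, `n^{k+l} ≤ 2^{(log₂ n + c)^c}`") and
`stub_narrowExpressionCompression`.  The first stub carries NO symmetry hypothesis on the family, only on
the circuit — and that is not enough:

* closed pattern expressions are MATRIX-symmetric (invariant under INDEPENDENT row and column
  permutations, `PatternExpr.rename_perm_close`), whereas
* square-symmetric circuits (DIAGONAL action of `Sym_n`) of quasi-polynomial orbit size compute every
  DIAGONALLY invariant family of polylogarithmic degree (`qpOrbit_of_polylogDegree_of_diagInvariant`,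
  the orbit circuit of the tree) — e.g. the trace `Σ_i x_ii`, which is not matrix-symmetric at `n = 2`.

So `not_stub_orbitToNarrowExpression` refutes the registered signature (witness: the trace family).
REPAIR (the composition `OrbitCompressionQP_of` has the hypothesis in context): add matrix symmetry of
`f`, i.e. the stub should read
`∀ f, (∀ n σ τ, rename (σ × τ) (f n) = f n) → (qp-orbit square-symmetric circuits) → (narrow expressions)`;
the trace witness misses the repaired statement (`trace_two_not_matrixSymmetric`).  CAVEAT recorded for
the planner: even repaired, the stub is not a verbatim port of Dawar–Pago–Seppelt 2025 Thm 1.1, whose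
bipartite hom-polynomial characterisation is for `Sym_n × Sym_m`-symmetric circuits; for the diagonal
action the supported gates are invariants of ONE-sorted (directed, looped) patterns, and passing to
bipartite expressions for a matrix-symmetric output is an additional step.

Helper file (`--supports stmt-ValiantsHypothesis-16191`); def-free; nothing here is a named fact.
-/

-- `Summit.ValiantsHypothesis.ValiantsHypothesis.…` is the tree's mandated namespace (Sub = Summit).
set_option linter.dupNamespace false

noncomputable section

namespace Summit.ValiantsHypothesis.ValiantsHypothesis.Theorems

namespace OrbitToNarrowExpression

open Literature.Computability.AlgebraicComplexity MvPolynomial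

/-- **Square-symmetric circuits of quasi-polynomial ORBIT size for every diagonally invariant family of
polylogarithmic degree** (orbit form of `monotoneRestorationQP_of_polylogDegree`, over `ℂ`, with only
DIAGONAL invariance assumed): the orbit circuit `OrbitCircuit.exists_symmetric_circuit_of_invariant` has
size, hence orbit size, `≤ n² + |supp|·n²·deg + 2|supp| + 1`, and `|supp| ≤ (n² + 1)^deg`. [folklore] -/
theorem qpOrbit_of_polylogDegree_of_diagInvariant
    (f : (n : ℕ) → MvPolynomial (Fin n × Fin n) ℂ)
    (hinv : ∀ (n : ℕ) (σ : Equiv.Perm (Fin n)),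
      rename (fun pq : Fin n × Fin n => σ • pq) (f n) = f n)
    (hdeg : ∃ c : ℕ, ∀ n : ℕ, (f n).totalDegree ≤ (Nat.log 2 n + c) ^ c) :
    ∃ c : ℕ, ∀ n : ℕ, ∃ (G : Type) (_ : Fintype G)
      (C : LabelledArithCircuit ℂ (Fin n × Fin n) Unit G),
      C.IsSymmetric (Equiv.Perm (Fin n)) ∧ C.eval (C.output ()) = f n ∧
      C.orbitSize (Equiv.Perm (Fin n)) ≤ 2 ^ ((Nat.log 2 n + c) ^ c) := by
  obtain ⟨c, hc⟩ := hdeg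
  obtain ⟨c₁, hc₁⟩ := SparseRegime.polylogDegree_sparse_le c
  obtain ⟨c', hc'⟩ := SparseRegime.qpSparse_size_le c₁
  refine ⟨c', fun n => ?_⟩
  obtain ⟨G, inst, C, hCs, hCe, hCc⟩ :=
    OrbitCircuit.exists_symmetric_circuit_of_invariant (f n) (hinv n)
  refine ⟨G, inst, C, hCs, hCe, (C.orbitSize_le_size (Equiv.Perm (Fin n))).trans
    (hCc.trans (hc' n _ _ ?_ (hc₁ n _ (hc n)).2))⟩
  calc (f n).support.card ≤ (Fintype.card (Fin n × Fin n) + 1) ^ (f n).totalDegree :=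
        OrbitCircuit.card_support_le_of_totalDegree_le (f n) le_rfl
    _ = (n * n + 1) ^ (f n).totalDegree := by rw [Fintype.card_prod, Fintype.card_fin]
    _ ≤ 2 ^ ((Nat.log 2 n + c₁) ^ c₁) := (hc₁ n _ (hc n)).1

/-- The trace `Σ_i x_ii` is invariant under the DIAGONAL action of `Sym_n`. [folklore] -/
theorem trace_diagInvariant (n : ℕ) (σ : Equiv.Perm (Fin n)) :
    rename (fun pq : Fin n × Fin n => σ • pq) (∑ i : Fin n, (X (i, i) : MvPolynomial _ ℂ)) =
      ∑ i : Fin n, X (i, i) := by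
  simp only [map_sum, rename_X]
  exact Fintype.sum_equiv σ _ _ fun i => rfl

/-- The trace has total degree `≤ 1`. [folklore] -/
theorem totalDegree_trace_le (n : ℕ) :
    (∑ i : Fin n, (X (i, i) : MvPolynomial (Fin n × Fin n) ℂ)).totalDegree ≤ 1 :=
  (totalDegree_finsetSum _ _).trans (Finset.sup_le fun i _ => (totalDegree_X (R := ℂ) (i, i)).le)

/-- **The trace family has square-symmetric circuits of quasi-polynomial orbit size** (the hypothesis
of the registered stub). [folklore] -/
theorem trace_qpOrbit :
    ∃ c : ℕ, ∀ n : ℕ, ∃ (G : Type) (_ : Fintype G)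
      (C : LabelledArithCircuit ℂ (Fin n × Fin n) Unit G),
      C.IsSymmetric (Equiv.Perm (Fin n)) ∧
      C.eval (C.output ()) = ∑ i : Fin n, (X (i, i) : MvPolynomial _ ℂ) ∧
      C.orbitSize (Equiv.Perm (Fin n)) ≤ 2 ^ ((Nat.log 2 n + c) ^ c) :=
  qpOrbit_of_polylogDegree_of_diagInvariant _ trace_diagInvariant
    ⟨1, fun n => (totalDegree_trace_le n).trans (by simp)⟩

/-- **The trace is not matrix-symmetric at `n = 2`**: swapping the two ROWS only sends
`x_00 + x_11` to `x_10 + x_01`. [folklore] -/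
theorem trace_two_not_matrixSymmetric :
    rename (fun p : Fin 2 × Fin 2 => (Equiv.swap (0 : Fin 2) 1 p.1, p.2))
      (∑ i : Fin 2, (X (i, i) : MvPolynomial _ ℂ)) ≠ ∑ i : Fin 2, X (i, i) := by
  intro h
  have hc := congrArg (coeff (Finsupp.single ((0 : Fin 2), (0 : Fin 2)) 1)) h
  simp only [Fin.sum_univ_two, coeff_add, coeff_X] at hc
  simp [Finsupp.single_eq_single_iff] at hc

/-- No closed pattern expression equals the trace at level `2` (closed expressions are
matrix-symmetric, `PatternExpr.rename_perm_close`). [folklore] -/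
theorem close_two_ne_trace (k l : ℕ) (e : PatternExpr ℂ k l) :
    e.close 2 ≠ ∑ i : Fin 2, (X (i, i) : MvPolynomial _ ℂ) := by
  intro h
  apply trace_two_not_matrixSymmetric
  have := PatternExpr.rename_perm_close (R := ℂ) 2 (Equiv.swap (0 : Fin 2) 1) 1 e
  rw [h] at this
  simpa using this

/-- **`stub_orbitToNarrowExpression` of line `expression_compression` (crux workfile
`Cruxes/OrbitCompressionQP/Lines/expression_compression.lean`, registered 2026-08-31) is FALSE as
stated** — verbatim its signature, negated.  Witness: the trace family `f n = Σ_i x_ii` (square-symmetric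
circuits of quasi-polynomial orbit size by `trace_qpOrbit`; not a closed pattern expression at `n = 2` by
`close_two_ne_trace`).  Class: refuted-MISSTATED — the repaired stub adds the matrix symmetry of `f`
(available in `OrbitCompressionQP_of`), and the witness misses the repaired statement
(`trace_two_not_matrixSymmetric`). [folklore] -/
theorem not_stub_orbitToNarrowExpression :
    ¬ (∀ f : (n : ℕ) → MvPolynomial (Fin n × Fin n) ℂ,
      (∃ c : ℕ, ∀ n : ℕ, ∃ (G : Type) (_ : Fintype G)
          (C : LabelledArithCircuit ℂ (Fin n × Fin n) Unit G),
        C.IsSymmetric (Equiv.Perm (Fin n)) ∧ C.eval (C.output ()) = f n ∧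
        C.orbitSize (Equiv.Perm (Fin n)) ≤ 2 ^ ((Nat.log 2 n + c) ^ c)) →
      ∃ c : ℕ, ∀ n : ℕ, 1 ≤ n → ∃ (k l : ℕ) (e : PatternExpr ℂ k l),
        n ^ (k + l) ≤ 2 ^ ((Nat.log 2 n + c) ^ c) ∧ e.close n = f n) := by
  intro h
  obtain ⟨c, hc⟩ := h (fun n => ∑ i : Fin n, (X (i, i) : MvPolynomial _ ℂ)) trace_qpOrbit
  obtain ⟨k, l, e, -, he⟩ := hc 2 (by norm_num)
  exact close_two_ne_trace k l e he

end OrbitToNarrowExpression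

end Summit.ValiantsHypothesis.ValiantsHypothesis.Theorems

end
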